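import Literature.Analysis.FluidPDE.FractionalNSReynoldsWeakIdentity
import HarnessLib

/-!
# The fractional Navier–Stokes–Reynolds system: scaling, and uniform limits with vanishing stress

Analysis/FluidPDE proofs-only complement to `Literature.Analysis.FluidPDE.FractionalNSReynolds`
(`Torus.IsFracNSReynoldsOn S θ ν v p R`: smooth solutions of
`∂ₜv + ∇·(v ⊗ v) + ∇p + ν(-Δ)^θ v = ∇·R`, `∇·v = 0`, `R` symmetric — Luo–Titi 2020, (2.1); with
`tr R = 0`, `∫p = 0` added, De Rosa 2019, §4.1 (NSR), the relaxation driving De Rosa's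
convex-integration scheme for the hypodissipative system) and to
`FractionalNSReynoldsWeakIdentity` (`IsFracNSReynoldsOn.weak_identity`). It supplies what the
passage "iteration ⇒ weak solution" of De Rosa 2019, §4.2 (proof of Thm. 2.1) consumes, in the
manner of the tree's `EulerReynolds` for the Buckmaster–De Lellis–Székelyhidi–Vicol scheme:

* `Torus.IsEulerReynoldsOn.isFracNSReynoldsOn_zero_visc` — an Euler–Reynolds triple solves the
  system with `ν = 0`;
* `Torus.IsFracNSReynoldsOn.weak_identity_Ioo` — the weak identity with Reynolds defect on
  `[0, T]` against the test fields `Torus.IsSpaceTimeTestIoo T` of the distributional formulation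
  `Torus.IsWeakFracNSSolutionOn` (`FractionalNSTorus`), a specialisation of
  `IsFracNSReynoldsOn.weak_identity`;
* `Torus.IsFracNSReynoldsOn.timeRescale` — the scaling `(v, p, R)(t,x) ↦ (c v, c² p, c² R)(ct, x)`
  maps solutions with viscosity `ν` on `[0,T]` to solutions with viscosity `c ν` on `[0, T/c]`
  (De Rosa 2019, §4.2, (4.12)–(4.13): "`ṽ(x,t) := μ v(x, μt)`, `p̃(x,t) := μ² p(x, μt)` … the
  stated problem reduces to finding a solution `(ṽ, p̃)` of `∂ₜṽ + ṽ·∇ṽ + ∇p̃ + μ(-Δ)^γ ṽ = 0`");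
* `Torus.isWeakFracNSSolutionOn_of_unifLimit` — if `(v_q, p_q, R_q)` solve the system on
  `[0,T] × T^d` with `v_q → u` uniformly and `‖R_q‖₀ → 0`, then `u` is a weak solution of the
  fractional Navier–Stokes system on `T^d × (0,T)` (`Torus.IsWeakFracNSSolutionOn T θ ν u`;
  De Rosa 2019, §4.2: "Since `R̊_q → 0` uniformly, the pair `(ṽ, p̃)` solves equations (4.13)").

Also two pointwise linearity lemmas for the spectral fractional Laplacian
(`Torus.fracLaplacian_const_smul_apply`, `Torus.fracLaplacian_fun_zero`; the function-level
`Torus.fracLaplacian_const_smul` lives in `FractionalNSPrescribedEnergyProlongationProofs`, not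
imported here). General dimension `d`; the analytic lemmas need `θ ≥ 0` only.

## References

* L. De Rosa, *Infinitely many Leray–Hopf solutions for the fractional Navier–Stokes equations*,
  Comm. PDE 44 (2019), 335–365 = arXiv:1801.10235, §4.1 (system (NSR)), §4.2 ((4.12)–(4.13),
  iteration from zero, passage to the limit). [`Derosa2018`]
* T. Luo, E. S. Titi, Calc. Var. PDE 59 (2020) = arXiv:1808.07595, §2.1 (2.1). [`LuoTiti2020`]
* T. Buckmaster, C. De Lellis, L. Székelyhidi Jr., V. Vicol, CPAM 72 (2019), §2.2 (scaling and
  passage to the limit in the Euler–Reynolds system). [`BuckmasterEtAl2018`]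
-/

open MeasureTheory Set Topology Filter
open scoped InnerProductSpace ContDiff ENNReal

noncomputable section

namespace Literature.Analysis.FluidPDE

namespace Torus

variable {d : Type*} [Fintype d] [DecidableEq d]

/-! ## Linearity of `(-Δ)^γ` in the field (local copies) -/

section Linear

omit [DecidableEq d] in
/-- `(-Δ)^γ (c • ψ) = c • (-Δ)^γ ψ` pointwise, for a real constant `c` (linearity of the Fourier
coefficients and of the defining series; no smoothness needed). Local copy of
`Torus.fracLaplacian_const_smul` of `FractionalNSPrescribedEnergyProlongationProofs` (not imported
here, to keep this definitions file light). [folklore] -/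
theorem fracLaplacian_const_smul_apply (γ c : ℝ) (ψ : UnitAddTorus d → EuclideanSpace ℝ d)
    (x : UnitAddTorus d) : fracLaplacian γ (c • ψ) x = c • fracLaplacian γ ψ x := by
  have hc : (FunctionSpaces.EuclideanSpace.complexify ∘ (c • ψ)) =
      (c : ℂ) • (FunctionSpaces.EuclideanSpace.complexify ∘ ψ) := by
    funext y
    simp only [Function.comp_apply, Pi.smul_apply, LinearIsometry.map_smul]
    exact RCLike.real_smul_eq_coe_smul (K := ℂ) c _
  rw [fracLaplacian_def, fracLaplacian_def, hc]
  simp_rw [FunctionSpaces.Torus.mFourierCoeff_const_smul, smul_comm (UnitAddTorus.mFourier _ x) (c : ℂ),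
    smul_comm (fracSymbol γ _) (c : ℂ)]
  rw [tsum_const_smul'' (c : ℂ)]
  exact ContinuousLinearMap.map_smul FunctionSpaces.EuclideanSpace.realPart c _

omit [DecidableEq d] in
/-- `(-Δ)^γ` of the zero field vanishes pointwise (lambda form of `fracLaplacian_zero_fun`). [folklore] -/
@[simp]
theorem fracLaplacian_fun_zero (γ : ℝ) (x : UnitAddTorus d) :
    fracLaplacian γ (fun _ : UnitAddTorus d => (0 : EuclideanSpace ℝ d)) x = 0 := by
  exact congrFun (fracLaplacian_zero_fun (d := d) γ) x

end Linear

/-! ## Relation with the Euler–Reynolds system; the weak identity on `[0, T]` -/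

section FracNSReynolds

variable {S : Set ℝ} {T θ ν : ℝ} {v : ℝ → UnitAddTorus d → EuclideanSpace ℝ d}
  {p : ℝ → UnitAddTorus d → ℝ} {R : ℝ → UnitAddTorus d → d → EuclideanSpace ℝ d}

/-- With zero viscosity the fractional Navier–Stokes–Reynolds system is the Euler–Reynolds system:
an Euler–Reynolds triple (`Torus.IsEulerReynoldsOn`, which moreover has trace-free stress and
mean-zero pressure) solves it with `ν = 0`, for any exponent. [folklore] -/
theorem IsEulerReynoldsOn.isFracNSReynoldsOn_zero_visc (h : IsEulerReynoldsOn S v p R) (θ : ℝ) :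
    IsFracNSReynoldsOn S θ 0 v p R where
  smooth_velocity := h.smooth_velocity
  smooth_pressure := h.smooth_pressure
  smooth_stress := h.smooth_stress
  momentum t ht x := by rw [zero_smul, add_zero]; exact h.momentum t ht x
  divFree := h.divFree
  symm := h.symm

/-- **The weak identity with Reynolds defect on `[0, T]`, against the test fields of the
distributional formulation.** For a classical solution on a time set `S ⊇ [0, T]`, `θ ≥ 0`, and a
smooth divergence-free test field `ψ` compactly supported in time in `(0, T)`
(`Torus.IsSpaceTimeTestIoo T ψ`),
`∫₀ᵀ∫ (⟪v, ∂ₜψ⟫ + ⟪v, (v·∇)ψ⟫ - ν⟪v, (-Δ)^θ ψ⟫) = ∫₀ᵀ∫ ∑ⱼ ⟪R^{(j)}, ∂ⱼψ⟫` — the left side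
being the functional of `Torus.IsWeakFracNSSolutionOn T θ ν` (`FractionalNSTorus`). Special case of
`IsFracNSReynoldsOn.weak_identity` (`ψ(0) = 0`, `ψ(T) = 0` from the support conditions); for
`T ≤ 0` both sides vanish. [cite: Derosa2018, §1 (weak formulation) and §4.2] -/
theorem IsFracNSReynoldsOn.weak_identity_Ioo (h : IsFracNSReynoldsOn S θ ν v p R) (hθ : 0 ≤ θ)
    (hS : Icc 0 T ⊆ S) {ψ : ℝ → UnitAddTorus d → EuclideanSpace ℝ d}
    (hψ : FunctionSpaces.Torus.IsSpaceTimeTestIoo T ψ) (hψdiv : FunctionSpaces.Torus.IsDivFreeTest ψ) :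
    ∫ t in Ioo 0 T, ∫ x, (⟪v t x, FunctionSpaces.Torus.timeDeriv ψ t x⟫_ℝ +
        ⟪v t x, FunctionSpaces.Torus.convect (v t) (ψ t) x⟫_ℝ - ν * ⟪v t x, fracLaplacian θ (ψ t) x⟫_ℝ) =
      ∫ t in Ioo 0 T, ∫ x, ∑ j, ⟪R t x j, FunctionSpaces.Torus.partialDeriv j (ψ t) x⟫_ℝ := by
  rcases le_or_gt T 0 with hT | hT
  · simp [Ioo_eq_empty (not_lt.2 hT)]
  obtain ⟨⟨hψs, T', hT'T, hT'⟩, ε, hε, hε0⟩ := id hψ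
  exact h.weak_identity hθ hS hT hψs (hε0 0 hε.le) (hT' T hT'T.le) hψdiv

end FracNSReynolds

/-! ## Scaling: `(v, p, R)(t, x) ↦ (c v, c² p, c² R)(c t, x)`, viscosity `ν ↦ c ν` -/

section Scaling

variable {T c θ ν : ℝ} {v : ℝ → UnitAddTorus d → EuclideanSpace ℝ d}
  {p : ℝ → UnitAddTorus d → ℝ} {R : ℝ → UnitAddTorus d → d → EuclideanSpace ℝ d}

/-- **Scaling of the fractional Navier–Stokes–Reynolds system.** If `(v, p, R)` solves (NSR) with
exponent `θ` and viscosity `ν` on `[0, T] × T^d` and `c > 0`, then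
`(t, x) ↦ (c v(ct, x), c² p(ct, x), c² R(ct, x))` solves it with the same exponent and viscosity
`c ν` on `[0, T/c] × T^d`: all terms of the momentum equation scale by `c²` except the
dissipative one, `(-Δ)^θ (c v(ct,·)) = c ((-Δ)^θ v)(ct, ·)`, whence the factor `c` on the
viscosity (De Rosa 2019, §4.2, (4.12)–(4.13): with `ṽ(x,t) = μ v(x, μt)`, `p̃(x,t) = μ² p(x, μt)`
the viscosity-`1` system becomes `∂ₜṽ + ṽ·∇ṽ + ∇p̃ + μ(-Δ)^γ ṽ = 0`).
[cite: Derosa2018, §4.2 (4.12)–(4.13)] -/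
theorem IsFracNSReynoldsOn.timeRescale (h : IsFracNSReynoldsOn (Icc 0 T) θ ν v p R) (hT : 0 < T)
    (hc : 0 < c) :
    IsFracNSReynoldsOn (Icc 0 (T / c)) θ (c * ν) (fun t x => c • v (c * t) x)
      (fun t x => c ^ 2 * p (c * t) x) (fun t x => c ^ 2 • R (c * t) x) := by
  have hct_mem : ∀ {t : ℝ}, t ∈ Icc 0 (T / c) → c * t ∈ Icc 0 T := fun {t} ht => by
    refine ⟨mul_nonneg hc.le ht.1, ?_⟩
    calc c * t ≤ c * (T / c) := mul_le_mul_of_nonneg_left ht.2 hc.le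
      _ = T := mul_div_cancel₀ T hc.ne'
  refine
    { smooth_velocity := (h.smooth_velocity.comp_mul_time hc).const_smul c
      smooth_pressure := by
        have := (h.smooth_pressure.comp_mul_time hc).const_smul (c ^ 2)
        simpa only [smul_eq_mul] using this
      smooth_stress := (h.smooth_stress.comp_mul_time hc).const_smul (c ^ 2)
      momentum := fun t ht x => ?_
      divFree := fun t ht x => ?_
      symm := fun t ht x i j => ?_ }
  · have hTc : 0 < T / c := div_pos hT hc
    have hct : c * t ∈ Icc 0 T := hct_mem ht
    have hvs : FunctionSpaces.Torus.IsSmooth (v (c * t)) := h.smooth_velocity.isSmooth_slice hct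
    have hps : FunctionSpaces.Torus.IsSmooth (p (c * t)) := h.smooth_pressure.isSmooth_slice hct
    have hRs : FunctionSpaces.Torus.IsSmooth (R (c * t)) := h.smooth_stress.isSmooth_slice hct
    -- time derivative: chain rule along `τ ↦ c τ`
    have h1 : FunctionSpaces.Torus.timeDerivWithin (Icc 0 (T / c)) (fun t x => c • v (c * t) x) t x =
        c • (c • FunctionSpaces.Torus.timeDerivWithin (Icc 0 T) v (c * t) x) := by
      have hg : HasDerivWithinAt (fun τ => v τ x) (FunctionSpaces.Torus.timeDerivWithin (Icc 0 T) v (c * t) x)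
          (Icc 0 T) (c * t) := h.smooth_velocity.hasDerivWithinAt_slice hct x
      have hh : HasDerivWithinAt (fun τ : ℝ => c * τ) c (Icc 0 (T / c)) t := by
        simpa using (hasDerivWithinAt_id t (Icc 0 (T / c))).const_mul c
      have hmaps : MapsTo (fun τ : ℝ => c * τ) (Icc 0 (T / c)) (Icc 0 T) := fun τ hτ => hct_mem hτ
      have hcomp := (hg.scomp t hh hmaps).const_smul c
      exact hcomp.derivWithin (uniqueDiffOn_Icc hTc t ht)
    have h2 : FunctionSpaces.Torus.convect (fun x => c • v (c * t) x) (fun x => c • v (c * t) x) x =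
        c • (c • FunctionSpaces.Torus.convect (v (c * t)) (v (c * t)) x) := by
      change FunctionSpaces.Torus.fderiv (c • v (c * t)) x (c • v (c * t) x) = _
      rw [FunctionSpaces.Torus.fderiv_const_smul (hvs.isContDiff (by simp)), FunLike.coe_smul, Pi.smul_apply,
        map_smul]
      rfl
    have h3 : FunctionSpaces.Torus.gradient (fun x => c ^ 2 * p (c * t) x) x =
        c ^ 2 • FunctionSpaces.Torus.gradient (p (c * t)) x := by
      change FunctionSpaces.Torus.gradient (c ^ 2 • p (c * t)) x = _
      exact gradient_const_smul (hps.isContDiff (by simp)) _ _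
    have h4 : tensorDivergence (fun x => c ^ 2 • R (c * t) x) x =
        c ^ 2 • tensorDivergence (R (c * t)) x := by
      change tensorDivergence (c ^ 2 • R (c * t)) x = _
      exact tensorDivergence_const_smul (hRs.isContDiff (by simp)) _ _
    have h5 : fracLaplacian θ (fun x => c • v (c * t) x) x = c • fracLaplacian θ (v (c * t)) x := by
      change fracLaplacian θ (c • v (c * t)) x = _
      exact fracLaplacian_const_smul_apply θ c _ x
    rw [h1, h2, h3, h4, h5, ← h.momentum (c * t) hct x, smul_smul, smul_smul, smul_smul, ← pow_two,
      smul_add, smul_add, smul_add, smul_smul (c ^ 2) ν]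
    congr 2
    ring
  · have hct : c * t ∈ Icc 0 T := hct_mem ht
    have hvs : FunctionSpaces.Torus.IsSmooth (v (c * t)) := h.smooth_velocity.isSmooth_slice hct
    change FunctionSpaces.Torus.divergence (c • v (c * t)) x = 0
    rw [divergence_const_smul (hvs.isContDiff (by simp)), h.divFree (c * t) hct x, mul_zero]
  · have hct : c * t ∈ Icc 0 T := hct_mem ht
    simp only [Pi.smul_apply, PiLp.smul_apply, smul_eq_mul]
    rw [h.symm (c * t) hct x i j]

omit [DecidableEq d] in
/-- The scaling preserves the two normalisations De Rosa adds to the system (§4.1, (4.3)–(4.4)):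
trace-free stress and mean-zero pressure. [cite: Derosa2018, §4.1 (4.3)–(4.4)] -/
theorem timeRescale_constraints (hc : 0 < c)
    (htr : ∀ t ∈ Icc 0 T, ∀ x, ∑ i, R t x i i = 0)
    (hmean : ∀ t ∈ Icc 0 T, FunctionSpaces.Torus.HasZeroMean (p t)) :
    (∀ t ∈ Icc 0 (T / c), ∀ x, ∑ i, (fun t x => c ^ 2 • R (c * t) x) t x i i = 0) ∧
      ∀ t ∈ Icc 0 (T / c), FunctionSpaces.Torus.HasZeroMean ((fun t x => c ^ 2 * p (c * t) x) t) := by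
  have hct_mem : ∀ {t : ℝ}, t ∈ Icc 0 (T / c) → c * t ∈ Icc 0 T := fun {t} ht => by
    refine ⟨mul_nonneg hc.le ht.1, ?_⟩
    calc c * t ≤ c * (T / c) := mul_le_mul_of_nonneg_left ht.2 hc.le
      _ = T := mul_div_cancel₀ T hc.ne'
  refine ⟨fun t ht x => ?_, fun t ht => ?_⟩
  · simp only [Pi.smul_apply, PiLp.smul_apply, smul_eq_mul, ← Finset.mul_sum, htr (c * t) (hct_mem ht) x,
      mul_zero]
  · have h0 := hmean (c * t) (hct_mem ht)
    unfold FunctionSpaces.Torus.HasZeroMean at h0 ⊢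
    rw [integral_const_mul, h0, mul_zero]

end Scaling

/-! ## Uniform limits of solutions of (NSR) with vanishing stress -/

section Limit

omit [DecidableEq d] in
/-- Pointwise stability of the weak integrand of the fractional system,
`⟪a, P⟫ + ⟪a, ∑ᵢ aᵢ Dᵢ⟫ - ν⟪a, Λ⟫` (with `Dᵢ = ∂ᵢψ`, `Λ = (-Δ)^γ ψ`): it is locally Lipschitz in
`a`, with constant `‖P‖ + card d · maxᵢ ‖Dᵢ‖ · (‖a‖ + ‖b‖) + |ν| ‖Λ‖` (from
`Torus.abs_weakIntegrand_sub_le`). [folklore] -/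
theorem abs_fracNSRWeakIntegrand_sub_le (a b P Λ : EuclideanSpace ℝ d) (D : d → EuclideanSpace ℝ d)
    (ν : ℝ) {K₁ K₂ K₃ : ℝ} (hP : ‖P‖ ≤ K₁) (hD : ∀ i, ‖D i‖ ≤ K₂) (hΛ : ‖Λ‖ ≤ K₃) :
    |(⟪a, P⟫_ℝ + ⟪a, ∑ i, a i • D i⟫_ℝ - ν * ⟪a, Λ⟫_ℝ) - (⟪b, P⟫_ℝ + ⟪b, ∑ i, b i • D i⟫_ℝ - ν * ⟪b, Λ⟫_ℝ)| ≤
      ‖a - b‖ * (K₁ + Fintype.card d * K₂ * (‖a‖ + ‖b‖) + |ν| * K₃) := by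
  have h1 := abs_weakIntegrand_sub_le a b P D hP hD
  have h2 : |ν * ⟪a, Λ⟫_ℝ - ν * ⟪b, Λ⟫_ℝ| ≤ ‖a - b‖ * (|ν| * K₃) := by
    rw [← mul_sub, ← inner_sub_left, abs_mul]
    calc |ν| * |⟪a - b, Λ⟫_ℝ| ≤ |ν| * (‖a - b‖ * K₃) :=
          mul_le_mul_of_nonneg_left ((abs_real_inner_le_norm _ _).trans
            (mul_le_mul_of_nonneg_left hΛ (norm_nonneg _))) (abs_nonneg ν)
      _ = ‖a - b‖ * (|ν| * K₃) := by ring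
  have e : (⟪a, P⟫_ℝ + ⟪a, ∑ i, a i • D i⟫_ℝ - ν * ⟪a, Λ⟫_ℝ) - (⟪b, P⟫_ℝ + ⟪b, ∑ i, b i • D i⟫_ℝ - ν * ⟪b, Λ⟫_ℝ) =
      ((⟪a, P⟫_ℝ + ⟪a, ∑ i, a i • D i⟫_ℝ) - (⟪b, P⟫_ℝ + ⟪b, ∑ i, b i • D i⟫_ℝ)) -
        (ν * ⟪a, Λ⟫_ℝ - ν * ⟪b, Λ⟫_ℝ) := by ring
  rw [e]
  calc _ ≤ |(⟪a, P⟫_ℝ + ⟪a, ∑ i, a i • D i⟫_ℝ) - (⟪b, P⟫_ℝ + ⟪b, ∑ i, b i • D i⟫_ℝ)| +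
        |ν * ⟪a, Λ⟫_ℝ - ν * ⟪b, Λ⟫_ℝ| := abs_sub _ _
    _ ≤ ‖a - b‖ * (K₁ + Fintype.card d * K₂ * (‖a‖ + ‖b‖)) + ‖a - b‖ * (|ν| * K₃) := add_le_add h1 h2
    _ = ‖a - b‖ * (K₁ + Fintype.card d * K₂ * (‖a‖ + ‖b‖) + |ν| * K₃) := by ring

/-- The space–time lift of the weak integrand `⟪w, ∂ₜψ⟫ + ⟪w, (w·∇)ψ⟫ - ν⟪w, (-Δ)^γ ψ⟫` of a field
`w` with continuous lift on `[0,T] × ℝ^d`, against a test field `ψ` smooth on `ℝ × T^d`, is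
continuous on `[0,T] × ℝ^d` (`γ ≥ 0`; joint continuity of `(-Δ)^γ ψ`,
`Torus.continuous_stLift_fracLaplacian`). [folklore] -/
theorem continuousOn_stLift_fracWeakIntegrand {T γ : ℝ} (hγ : 0 ≤ γ) (ν : ℝ) (hT : 0 < T)
    {ψ : ℝ → UnitAddTorus d → EuclideanSpace ℝ d} (hψs : ContDiff ℝ ∞ (FunctionSpaces.Torus.stLift ψ))
    {w : ℝ → UnitAddTorus d → EuclideanSpace ℝ d}
    (hwc : ContinuousOn (FunctionSpaces.Torus.stLift w) (Icc 0 T ×ˢ univ)) :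
    ContinuousOn (FunctionSpaces.Torus.stLift fun t x =>
      ⟪w t x, FunctionSpaces.Torus.timeDeriv ψ t x⟫_ℝ + ⟪w t x, FunctionSpaces.Torus.convect (w t) (ψ t) x⟫_ℝ -
        ν * ⟪w t x, fracLaplacian γ (ψ t) x⟫_ℝ) (Icc 0 T ×ˢ univ) := by
  have hU : UniqueDiffOn ℝ (Icc 0 T) := uniqueDiffOn_Icc hT
  have hψI : FunctionSpaces.Torus.IsSmoothSpaceTimeOn (Icc 0 T) ψ := hψs.contDiffOn
  have hψuniv : FunctionSpaces.Torus.IsSmoothSpaceTimeOn univ ψ := hψs.contDiffOn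
  have hψ'I : FunctionSpaces.Torus.IsSmoothSpaceTimeOn (Icc 0 T) (FunctionSpaces.Torus.timeDeriv ψ) :=
    (contDiff_stLift_timeDeriv hψs).contDiffOn
  have hDψ : ∀ j, FunctionSpaces.Torus.IsSmoothSpaceTimeOn (Icc 0 T)
      (fun t => FunctionSpaces.Torus.partialDeriv j (ψ t)) := fun j => hψI.partialDeriv hU j
  have hconv : ∀ (t : ℝ) (x : UnitAddTorus d),
      FunctionSpaces.Torus.convect (w t) (ψ t) x = ∑ i, w t x i • FunctionSpaces.Torus.partialDeriv i (ψ t) x :=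
    fun t x => FunctionSpaces.Torus.fderiv_apply_eq_sum_partialDeriv
      ((hψuniv.isSmooth_slice (mem_univ t)).isContDiff (by simp)) x (w t x)
  have e : (FunctionSpaces.Torus.stLift fun t x =>
      ⟪w t x, FunctionSpaces.Torus.timeDeriv ψ t x⟫_ℝ + ⟪w t x, FunctionSpaces.Torus.convect (w t) (ψ t) x⟫_ℝ -
        ν * ⟪w t x, fracLaplacian γ (ψ t) x⟫_ℝ) =
      fun z => ⟪FunctionSpaces.Torus.stLift w z, FunctionSpaces.Torus.stLift (FunctionSpaces.Torus.timeDeriv ψ) z⟫_ℝ +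
        ⟪FunctionSpaces.Torus.stLift w z, ∑ i, (FunctionSpaces.Torus.stLift w z) i •
          FunctionSpaces.Torus.stLift (fun t => FunctionSpaces.Torus.partialDeriv i (ψ t)) z⟫_ℝ -
        ν * ⟪FunctionSpaces.Torus.stLift w z, FunctionSpaces.Torus.stLift (fun t => fracLaplacian γ (ψ t)) z⟫_ℝ := by
    funext z
    obtain ⟨t, y⟩ := z
    simp only [FunctionSpaces.Torus.stLift_apply, hconv]
  rw [e]
  refine ((hwc.inner hψ'I.continuousOn_stLift).add (hwc.inner ?_)).sub
    (continuousOn_const.mul (hwc.inner (continuous_stLift_fracLaplacian hγ hψuniv).continuousOn))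
  refine continuousOn_finsetSum _ fun i _ => ?_
  exact ((EuclideanSpace.proj i).continuous.comp_continuousOn hwc).smul (hDψ i).continuousOn_stLift

/-- **Uniform limits of solutions of (NSR) with vanishing stress are weak solutions of the
fractional Navier–Stokes system** (De Rosa 2019, §4.2: "by (4.12) `v_q` converges uniformly to
some continuous `ṽ` … Since `R̊_q → 0` uniformly, the pair `(ṽ, p̃)` solves equations (4.13)").
Precisely: if `(v_q, p_q, R_q)` are classical solutions of (NSR) with exponent `γ ≥ 0` and
viscosity `ν` on `[0, T] × T^d`, `v_q → u` uniformly on `[0, T] × T^d` and `‖R_q‖₀ → 0`, then `u`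
is a weak (distributional, pressure-free) solution on `T^d × (0, T)` in the sense of
`Torus.IsWeakFracNSSolutionOn T γ ν u` (`FractionalNSTorus`). Proof as for
`Torus.isWeakEulerSolutionOn_of_unifLimit`: `u` is continuous on the compact `[0, T] × T^d`, hence
measurable and square integrable; `∫⟪u(t), ∇θ⟫ = lim ∫⟪v_q(t), ∇θ⟫ = 0`; and by
`Torus.IsFracNSReynoldsOn.weak_identity_Ioo` the functional of `v_q` equals the Reynolds defect, which
tends to `0` (`Torus.norm_integral_reynoldsDefect_le`), while it converges to the functional of
`u` by uniform convergence (`(-Δ)^γ ψ` being bounded on `[0,T] × T^d`,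
`Torus.exists_norm_fracLaplacian_le`). [cite: Derosa2018, §4.2] -/
theorem isWeakFracNSSolutionOn_of_unifLimit {T γ ν : ℝ} (hT : 0 < T) (hγ : 0 ≤ γ)
    {v : ℕ → ℝ → UnitAddTorus d → EuclideanSpace ℝ d} {p : ℕ → ℝ → UnitAddTorus d → ℝ}
    {R : ℕ → ℝ → UnitAddTorus d → d → EuclideanSpace ℝ d}
    {u : ℝ → UnitAddTorus d → EuclideanSpace ℝ d}
    (h : ∀ q, IsFracNSReynoldsOn (Icc 0 T) γ ν (v q) (p q) (R q))
    (hv : ∀ ε > 0, ∃ N, ∀ q ≥ N, ∀ t ∈ Icc 0 T, ∀ x, ‖v q t x - u t x‖ ≤ ε)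
    (hR : ∀ ε > 0, ∃ N, ∀ q ≥ N, ∀ t ∈ Icc 0 T, ∀ x, ‖R q t x‖ ≤ ε) :
    IsWeakFracNSSolutionOn T γ ν u := by
  have hU : UniqueDiffOn ℝ (Icc 0 T) := uniqueDiffOn_Icc hT
  have hvc : ∀ q, ContinuousOn (FunctionSpaces.Torus.stLift (v q)) (Icc 0 T ×ˢ univ) := fun q =>
    (h q).smooth_velocity.continuousOn_stLift
  have huc : ContinuousOn (FunctionSpaces.Torus.stLift u) (Icc 0 T ×ˢ univ) := continuousOn_stLift_of_unifLimit hvc hv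
  obtain ⟨C, hC⟩ := FunctionSpaces.Torus.exists_norm_le_of_continuousOn_of_isCompact huc isCompact_Icc subset_rfl
  have hC0 : 0 ≤ C := (norm_nonneg _).trans (hC 0 ⟨le_rfl, hT.le⟩ 0)
  refine ⟨?_, ?_, ?_, ?_⟩
  -- (1) measurability on `(0,T) × ℝ^d`
  · exact (huc.mono (prod_mono Ioo_subset_Icc_self subset_rfl)).aestronglyMeasurable
      (measurableSet_Ioo.prod MeasurableSet.univ)
  -- (2) square integrability from the uniform bound
  · have hb : ∀ t ∈ Ioo 0 T, ∀ x, ‖u t x‖ₑ ^ 2 ≤ ENNReal.ofReal C ^ 2 := by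
      intro t ht x
      gcongr
      rw [← ofReal_norm]
      exact ENNReal.ofReal_le_ofReal (hC t (Ioo_subset_Icc_self ht) x)
    calc ∫⁻ t in Ioo 0 T, ∫⁻ x, ‖u t x‖ₑ ^ 2
        ≤ ∫⁻ _ in Ioo 0 T, ENNReal.ofReal C ^ 2 :=
          setLIntegral_mono' measurableSet_Ioo fun t ht =>
            calc ∫⁻ x, ‖u t x‖ₑ ^ 2 ≤ ∫⁻ _, ENNReal.ofReal C ^ 2 := lintegral_mono (hb t ht)
              _ = ENNReal.ofReal C ^ 2 := by rw [lintegral_const, measure_univ, mul_one]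
      _ = ENNReal.ofReal C ^ 2 * volume (Ioo 0 T) := setLIntegral_const _ _
      _ < ⊤ := ENNReal.mul_lt_top (ENNReal.pow_lt_top ENNReal.ofReal_lt_top)
          (by rw [Real.volume_Ioo]; exact ENNReal.ofReal_lt_top)
  -- (3) `u(t)` is weakly divergence free for every `t ∈ (0,T)`
  · refine (ae_restrict_iff' measurableSet_Ioo).2 (ae_of_all _ fun t ht => ?_)
    have htI : t ∈ Icc 0 T := Ioo_subset_Icc_self ht
    intro θ hθ
    have hgc : Continuous (FunctionSpaces.Torus.gradient θ) := hθ.gradient.continuous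
    obtain ⟨Kθ, hKθ⟩ := isCompact_univ.exists_bound_of_continuousOn hgc.continuousOn
    have hKθ' : ∀ x, ‖FunctionSpaces.Torus.gradient θ x‖ ≤ Kθ := fun x => hKθ x (mem_univ x)
    have hK0 : 0 ≤ Kθ := (norm_nonneg _).trans (hKθ' 0)
    have hut : Continuous (u t) := FunctionSpaces.Torus.continuous_slice_of_continuousOn_stLift huc htI
    have hiu : Integrable (fun x => ⟪u t x, FunctionSpaces.Torus.gradient θ x⟫_ℝ) volume :=
      (hut.inner hgc).integrable_unitAddTorus
    refine norm_le_zero_iff.1 (le_of_forall_pos_le_add fun ε hε => ?_)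
    rw [zero_add]
    obtain ⟨N, hN⟩ := hv (ε / (Kθ + 1)) (div_pos hε (by linarith))
    have hvt : FunctionSpaces.Torus.IsSmooth (v N t) := (h N).smooth_velocity.isSmooth_slice htI
    have hiv : Integrable (fun x => ⟪v N t x, FunctionSpaces.Torus.gradient θ x⟫_ℝ) volume :=
      (hvt.inner hθ.gradient).integrable
    have h0 : ∫ x, ⟪v N t x, FunctionSpaces.Torus.gradient θ x⟫_ℝ = 0 :=
      ((h N).divFree t htI).isWeaklyDivFree_holds hvt θ hθ
    have hsub : ∫ x, ⟪u t x, FunctionSpaces.Torus.gradient θ x⟫_ℝ =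
        ∫ x, ⟪u t x - v N t x, FunctionSpaces.Torus.gradient θ x⟫_ℝ := by
      simp_rw [inner_sub_left]
      rw [integral_sub hiu hiv, h0, sub_zero]
    rw [hsub]
    calc ‖∫ x, ⟪u t x - v N t x, FunctionSpaces.Torus.gradient θ x⟫_ℝ‖
        ≤ (ε / (Kθ + 1) * Kθ) * (volume : Measure (UnitAddTorus d)).real univ := by
          refine norm_integral_le_of_norm_le_const (ae_of_all _ fun x => ?_)
          calc ‖⟪u t x - v N t x, FunctionSpaces.Torus.gradient θ x⟫_ℝ‖
              ≤ ‖u t x - v N t x‖ * ‖FunctionSpaces.Torus.gradient θ x‖ := norm_inner_le_norm _ _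
            _ ≤ ε / (Kθ + 1) * Kθ := by
                refine mul_le_mul ?_ (hKθ' x) (norm_nonneg _) (div_pos hε (by linarith)).le
                rw [norm_sub_rev]
                exact hN N le_rfl t htI x
      _ = ε / (Kθ + 1) * Kθ := by simp
      _ ≤ ε := by
          rw [div_mul_eq_mul_div, div_le_iff₀ (by linarith)]
          nlinarith
  -- (4) the weak identity
  · intro ψ hψ hψdiv
    have hψs : ContDiff ℝ ∞ (FunctionSpaces.Torus.stLift ψ) := hψ.1.1
    have hψI : FunctionSpaces.Torus.IsSmoothSpaceTimeOn (Icc 0 T) ψ := hψs.contDiffOn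
    have hψuniv : FunctionSpaces.Torus.IsSmoothSpaceTimeOn univ ψ := hψs.contDiffOn
    have hψ'I : FunctionSpaces.Torus.IsSmoothSpaceTimeOn (Icc 0 T) (FunctionSpaces.Torus.timeDeriv ψ) :=
      hψ.1.timeDeriv.1.contDiffOn
    have hDψ : ∀ j, FunctionSpaces.Torus.IsSmoothSpaceTimeOn (Icc 0 T)
        (fun t => FunctionSpaces.Torus.partialDeriv j (ψ t)) := fun j => hψI.partialDeriv hU j
    obtain ⟨K₁, hK₁⟩ := hψ'I.exists_norm_le_of_isCompact isCompact_Icc subset_rfl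
    have hK₁0 : 0 ≤ K₁ := (norm_nonneg _).trans (hK₁ 0 ⟨le_rfl, hT.le⟩ 0)
    obtain ⟨K₂, hK₂0, hK₂⟩ : ∃ K₂, 0 ≤ K₂ ∧
        ∀ j, ∀ t ∈ Icc 0 T, ∀ x, ‖FunctionSpaces.Torus.partialDeriv j (ψ t) x‖ ≤ K₂ := by
      choose K hK using fun j => (hDψ j).exists_norm_le_of_isCompact isCompact_Icc subset_rfl
      refine ⟨∑ j, |K j|, Finset.sum_nonneg fun j _ => abs_nonneg _, fun j t ht x => ?_⟩
      exact ((hK j t ht x).trans (le_abs_self _)).trans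
        (Finset.single_le_sum (fun i _ => abs_nonneg (K i)) (Finset.mem_univ j))
    obtain ⟨K₃, hK₃0, hK₃⟩ := exists_norm_fracLaplacian_le hγ hψuniv (isCompact_Icc (a := (0 : ℝ)) (b := T))
    -- the weak integrand in coordinates: `⟪w, (w·∇)ψ⟫ = ⟪w, ∑ᵢ wᵢ ∂ᵢψ⟫`
    have hconv : ∀ (w : UnitAddTorus d → EuclideanSpace ℝ d) (t : ℝ) (x : UnitAddTorus d),
        FunctionSpaces.Torus.convect w (ψ t) x = ∑ i, w x i • FunctionSpaces.Torus.partialDeriv i (ψ t) x :=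
      fun w t x => FunctionSpaces.Torus.fderiv_apply_eq_sum_partialDeriv
        ((hψ.1.isSmooth_slice t).isContDiff (by simp)) x (w x)
    -- continuity of the space–time lifts of the integrands
    have hGu := continuousOn_stLift_fracWeakIntegrand hγ ν hT hψs huc
    have hGv := fun q => continuousOn_stLift_fracWeakIntegrand hγ ν hT hψs (hvc q)
    -- main estimate: the functional of `u` is bounded by every `ε > 0`
    refine norm_eq_zero.1 (le_antisymm (le_of_forall_pos_le_add fun ε hε => ?_) (norm_nonneg _))
    rw [zero_add]
    set L : ℝ := K₁ + Fintype.card d * K₂ * (C + (C + 1)) + |ν| * K₃ with hL_def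
    have hL0 : 0 ≤ L := by positivity
    obtain ⟨N₁, hN₁⟩ := hv (min 1 (ε / (2 * (T * L + 1))))
      (lt_min one_pos (div_pos hε (by positivity)))
    obtain ⟨N₂, hN₂⟩ := hR (ε / (2 * (T * (Fintype.card d * K₂) + 1))) (div_pos hε (by positivity))
    have hq₁ := hN₁ (max N₁ N₂) (le_max_left _ _)
    have hq₂ := hN₂ (max N₁ N₂) (le_max_right _ _)
    set q : ℕ := max N₁ N₂ with hq_def
    -- (a) the Reynolds defect of `v_q` is small
    have hdefect : ‖∫ t in Ioo 0 T, ∫ x,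
        (⟪v q t x, FunctionSpaces.Torus.timeDeriv ψ t x⟫_ℝ + ⟪v q t x, FunctionSpaces.Torus.convect (v q t) (ψ t) x⟫_ℝ -
          ν * ⟪v q t x, fracLaplacian γ (ψ t) x⟫_ℝ)‖ ≤ ε / 2 := by
      rw [(h q).weak_identity_Ioo hγ subset_rfl hψ hψdiv]
      calc ‖∫ t in Ioo 0 T, ∫ x, ∑ j, ⟪R q t x j, FunctionSpaces.Torus.partialDeriv j (ψ t) x⟫_ℝ‖
          ≤ T * (Fintype.card d * (ε / (2 * (T * (Fintype.card d * K₂) + 1)) * K₂)) :=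
            norm_integral_reynoldsDefect_le hT.le (div_pos hε (by positivity)).le
              (fun t ht x => hq₂ t (Ioo_subset_Icc_self ht) x)
              (fun t ht x j => hK₂ j t (Ioo_subset_Icc_self ht) x)
        _ = (T * (Fintype.card d * K₂)) * (ε / (2 * (T * (Fintype.card d * K₂) + 1))) := by ring
        _ ≤ ε / 2 := by
            rw [mul_div_assoc', div_le_div_iff₀ (by positivity) (by positivity)]
            nlinarith [mul_nonneg hT.le (mul_nonneg (Nat.cast_nonneg (Fintype.card d)) hK₂0)]
    -- (b) the functionals of `u` and `v_q` are close
    have hclose : ‖(∫ t in Ioo 0 T, ∫ x,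
          (⟪u t x, FunctionSpaces.Torus.timeDeriv ψ t x⟫_ℝ + ⟪u t x, FunctionSpaces.Torus.convect (u t) (ψ t) x⟫_ℝ -
            ν * ⟪u t x, fracLaplacian γ (ψ t) x⟫_ℝ)) -
        ∫ t in Ioo 0 T, ∫ x,
          (⟪v q t x, FunctionSpaces.Torus.timeDeriv ψ t x⟫_ℝ + ⟪v q t x, FunctionSpaces.Torus.convect (v q t) (ψ t) x⟫_ℝ -
            ν * ⟪v q t x, fracLaplacian γ (ψ t) x⟫_ℝ)‖ ≤ ε / 2 := by
      have hη : ∀ t ∈ Ioo 0 T, ∀ x,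
          ‖(⟪u t x, FunctionSpaces.Torus.timeDeriv ψ t x⟫_ℝ + ⟪u t x, FunctionSpaces.Torus.convect (u t) (ψ t) x⟫_ℝ -
              ν * ⟪u t x, fracLaplacian γ (ψ t) x⟫_ℝ) -
            (⟪v q t x, FunctionSpaces.Torus.timeDeriv ψ t x⟫_ℝ + ⟪v q t x, FunctionSpaces.Torus.convect (v q t) (ψ t) x⟫_ℝ -
              ν * ⟪v q t x, fracLaplacian γ (ψ t) x⟫_ℝ)‖ ≤
            min 1 (ε / (2 * (T * L + 1))) * L := by
        intro t ht x
        have htI : t ∈ Icc 0 T := Ioo_subset_Icc_self ht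
        have hd : ‖u t x - v q t x‖ ≤ min 1 (ε / (2 * (T * L + 1))) := by
          rw [norm_sub_rev]; exact hq₁ t htI x
        have hvb : ‖v q t x‖ ≤ C + 1 := by
          calc ‖v q t x‖ = ‖(v q t x - u t x) + u t x‖ := by rw [sub_add_cancel]
            _ ≤ ‖v q t x - u t x‖ + ‖u t x‖ := norm_add_le _ _
            _ ≤ 1 + C := add_le_add ((hq₁ t htI x).trans (min_le_left _ _)) (hC t htI x)
            _ = C + 1 := add_comm _ _
        rw [Real.norm_eq_abs, hconv (u t) t x, hconv (v q t) t x]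
        calc |(⟪u t x, FunctionSpaces.Torus.timeDeriv ψ t x⟫_ℝ + ⟪u t x, ∑ i, u t x i • FunctionSpaces.Torus.partialDeriv i (ψ t) x⟫_ℝ -
                ν * ⟪u t x, fracLaplacian γ (ψ t) x⟫_ℝ) -
              (⟪v q t x, FunctionSpaces.Torus.timeDeriv ψ t x⟫_ℝ +
                ⟪v q t x, ∑ i, v q t x i • FunctionSpaces.Torus.partialDeriv i (ψ t) x⟫_ℝ -
                ν * ⟪v q t x, fracLaplacian γ (ψ t) x⟫_ℝ)|
            ≤ ‖u t x - v q t x‖ * (K₁ + Fintype.card d * K₂ * (‖u t x‖ + ‖v q t x‖) + |ν| * K₃) :=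
              abs_fracNSRWeakIntegrand_sub_le _ _ _ _ _ ν (hK₁ t htI x) (fun i => hK₂ i t htI x) (hK₃ t htI x)
          _ ≤ min 1 (ε / (2 * (T * L + 1))) * L := by
              refine mul_le_mul hd ?_ (by positivity) (le_min zero_le_one (by positivity))
              rw [hL_def]
              gcongr
              exact hC t htI x
      calc _ ≤ T * (min 1 (ε / (2 * (T * L + 1))) * L) :=
            norm_integral_sub_integral_le hT.le hGu (hGv q) hη
        _ ≤ T * (ε / (2 * (T * L + 1)) * L) := by gcongr; exact min_le_right _ _
        _ = (T * L) * (ε / (2 * (T * L + 1))) := by ring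
        _ ≤ ε / 2 := by
            rw [mul_div_assoc', div_le_div_iff₀ (by positivity) (by positivity)]
            nlinarith [mul_nonneg hT.le hL0]
    -- (c) conclude
    calc ‖∫ t in Ioo 0 T, ∫ x, (⟪u t x, FunctionSpaces.Torus.timeDeriv ψ t x⟫_ℝ +
          ⟪u t x, FunctionSpaces.Torus.convect (u t) (ψ t) x⟫_ℝ - ν * ⟪u t x, fracLaplacian γ (ψ t) x⟫_ℝ)‖
        ≤ ‖(∫ t in Ioo 0 T, ∫ x, (⟪u t x, FunctionSpaces.Torus.timeDeriv ψ t x⟫_ℝ +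
              ⟪u t x, FunctionSpaces.Torus.convect (u t) (ψ t) x⟫_ℝ - ν * ⟪u t x, fracLaplacian γ (ψ t) x⟫_ℝ)) -
            ∫ t in Ioo 0 T, ∫ x,
              (⟪v q t x, FunctionSpaces.Torus.timeDeriv ψ t x⟫_ℝ + ⟪v q t x, FunctionSpaces.Torus.convect (v q t) (ψ t) x⟫_ℝ -
                ν * ⟪v q t x, fracLaplacian γ (ψ t) x⟫_ℝ)‖ +
          ‖∫ t in Ioo 0 T, ∫ x,
              (⟪v q t x, FunctionSpaces.Torus.timeDeriv ψ t x⟫_ℝ + ⟪v q t x, FunctionSpaces.Torus.convect (v q t) (ψ t) x⟫_ℝ -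
                ν * ⟪v q t x, fracLaplacian γ (ψ t) x⟫_ℝ)‖ :=
          norm_le_norm_sub_add _ _
      _ ≤ ε / 2 + ε / 2 := add_le_add hclose hdefect
      _ = ε := add_halves ε

end Limit

end Torus

end Literature.Analysis.FluidPDE
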